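import Mathlib

/-!
# STUB-IDEAS `stub_heegnerIndexLowerAtTwo` — k = 2, g28: **R174″(a) EXECUTED (scoping verdict WITH PAGES
for the Λ-adic Coleman / explicit-reciprocity maps at additive `2`) + R174″(b) RE-TYPED as
«two PRINTED interpolation tables + one separation lemma + ONE named period digit `π_W`»**

Crux item `stmt-BirchSwinnertonDyer-27851` (`PrintCf2.SplitBadTwoLowerHalfOfFacts`), stub
`stub_heegnerIndexLowerAtTwo` (class: minimal models of `49a1^{(d)}, 49a2^{(d)}`, `d ≢ 1 (4)`, CM by
`K₀ = ℚ(√−7)`, `2 = 𝔭𝔮` split, additive potentially good ordinary at `2`, six dyadic keys, `W = A′^{(e)}`,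
`e ∈ {−1, 2, −2}`, `A′` the good-ordinary partner).  Technique of this seat: LITERATURE TRANSFER with a
typed dictionary (recent-theorem / open-question harvest).  BSD is NOT proved by any of this; nothing here
touches the route's `closes`, the registered skeleton or its stubs.

## The dictionary (object ↦ object), currency of the `(3)₂` cut of record (k3-g26, `NekovarCutK3G26`)

* `M` = `H¹_Iw(ℚ₂^cyc/ℚ₂, T(key))`, `T(key) = T_𝔭W|_{G_𝔮} = ℤ₂(β^{ur}χ_e)` (étale line at the étale prime);
  `Col : M →ₗ[k] k⟦T⟧` the Coleman / Perrin-Riou functional; `u i = loc_𝔮 z_{∞,Wᵢ}`; `𝓛 i` = cyclotomic line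
  of the two-variable CM measure of `Wᵢ`; the consumer is k3-g26's hypothesis `klf : ∀ i, Col (u i) = 𝓛 i`.
* `ev n` = evaluation at the `n`-th finite-order character of the line (`T ↦ ζ − 1`), meaningful on the
  BOUNDED submodule `B` (images of integral Λ-adic maps / integral measures);
  `Separates B ev` ⟸ Weierstrass preparation (Mathlib `PowerSeries.IsWeierstrassFactorizationAt`, tree
  `Literature/RingTheory/PowerSeries/WeierstrassFactorizationRoots.lean`).
* Kato-side table `tK i` : `ev n (Col (u i)) = cK i n * L i n` ⟸ (Coleman interpolation after the
  twist-shift `χ_e ↦ 1`, Kato Astérisque 295 §17.12 (17.12.1) p. 278 / Thm 16.4 (i) p. 270, `p = 2` allowed,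
  "(17.13.1) exact up to ×2 in the case p = 2" p. 279) ∘ (Kato Thm 12.5 (1) p. 221, finite-layer explicit
  reciprocity `Σ_σ χ(σ) per_f(σ(exp* z_γ)) = L_{(2N)}(f_W, χ, 1)·γ^±`, NO restriction on `p` or on `p ∣ N`;
  CM case proved in §15.16 p. 265 from (15.12.2) p. 263, with (15.16.1): Kato's zeta element of the CM form
  `f_W` IS the induced elliptic-unit class `z_{2^∞𝔣} ⊗ γ ⊗ (ζ_{2^n})^{⊗(−1)}`).
* Katz-side table `tZ i` : `ev n (𝓛 i) = cZ i n * L i n` ⟸ de Shalit 1987 II.4.12 (31) / II.4.14 (36)–(37),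
  `p` ANY split rational prime (explicit `p = 2` adjustments II.2.7, II.4.15 remark, II.4.17 "1 + 4ℤ₂ if
  p = 2"; the `p > 2` blanket is chapter III only), conductor guard `(𝔤, p) = 1` met by writing
  `ψ_W = ψ_{A′}·(χ_e∘N)` as in (37) (`φ` of conductor prime to `𝔭`, `χ` of finite order IN THE TOWER).
* digit column `cK i n = π i * cZ i n`: the Gauss-sum / Euler-factor shapes agree (Kato 16.4 (i):
  `Σ_{σ∈G_n} χ(σ)σ(·)` against `(p^{r-1}φ)^{-n}η′`; de Shalit (37): `G(ε) = φ(𝔭ⁿ)p^{-n}·Σ_γ χ(γ)(ζ_n^γ)^{-1}`),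
  leaving ONE value-grade constant per member: the PERIOD DIGIT
  `π_W := per_{f_W}^{(15.11.1)}(γ_B) / Ω(⟨Ω, Ω_p⟩ of II.4.12 (iv))` — key-uniformity of the `(3)₂` constant
  needs `v₂(π_W)` constant on a key (norm currency: a unit digit is invisible, `unit_digit_invisible`).

What is kernel-checked below (0 `sorry`, no instances, no notation, Mathlib only):
§1 `twistTransport` — H1: a Coleman functional for the crystalline shift `T(key) ⊗ χ_e⁻¹ = ℤ₂(β^{ur})`,
   transported through a `Tw_{χ_e}`-SEMILINEAR identification, is Λ-LINEAR on `M`; its value at a character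
   `φ` is the untwisted value at the SHIFTED character `φ ∘ Tw_{χ_e}⁻¹` (`eval_twistTransport`) — the typed
   form of "χ_e factors through `Gal(ℚ₂(μ₈)/ℚ₂) ⊂ G_∞`, so Iwasawa cohomology only sees a change of variable"
   (Venjakob 2013 Lemma twistL; k2-g12 §A / k2-g24 for the arithmetic of `μ₈`).
§2 `Separates`, `eq_of_separates` — H2: identity of two bounded series from equality of all their values.
§3 `ValueTable`, `klf_of_tables`, `klf_scaled_of_tables` — H3: R174″(b) ⟸ tK ∧ tZ ∧ (L-columns equal) ∧
   (digit columns equal, resp. proportional by `π i`): output literally k3-g26's `klf` (resp. `klf` up to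
   the scalar `π i`).
§4 `coeff_smul_eq`, `unit_digit_invisible`, `derivative_law_scaled` — H4: what a non-trivial digit does
   downstream: the `(3)₂` derivative coefficient scales by `π i`, and in NORM currency a unit digit drops out.
§5 `delta_descent_killed_by_two` — H5: the `Δ = {±1}`-descent digit at `p = 2` (Kato (12.1.2), p. 219).
§6 `eq_zero_of_forall_omega_dvd` — H2′ PROVED for every prime `p`: a series in `ℤ_p⟦X⟧` divisible by every
   `ω_n = (1+X)^{p^n} − 1` (i.e. vanishing at every `ζ_{p^n} − 1`) is `0` — the separation `Separates` needs.

VERDICT SUMMARY (R174″(a)): (V1) Coleman / PR map for `ℚ₂(β^{ur})` IN PRINT at 2 (Kato 16.4 p.270, §17.12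
p.278, (17.13.1) «×2 at p = 2» p.279; Berger 2003; Nakamura 2014 handles `Δ_K`); (V2) `χ_e` in the tower ⇒
transport, no new map; (V3) ε-iso: rational YES (Nakamura CJM 2017 Rem 2.5 p.300, Rem 2.10 p.307), integral on
the `μ_{2^∞}` tower NOT in print (Venjakob 2013 §2.2 «|Δ| prime to p» is on the tower, p0006) — not on the `klf`
path; (V4) Kato Thm 12.5(1)(2) p.221 any `p`, any `N`, CM case §15.16 p.265 with (15.16.1) zeta element =
elliptic-unit class; (V5) de Shalit II.4.12/4.14 at `p = 2`; (V6) BF24 rank-1 sequel: none.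
-/

namespace Summit.BirchSwinnertonDyer.BirchSwinnertonDyer.Cruxes.SplitBadTwoLowerHalfOfFacts.KatoColemanK2G28

open PowerSeries

/-! ## §1  H1 — twist-of-variable transport (semilinear data ↦ Λ-linear Coleman functional) -/

section Twist

variable {Λ : Type*} [CommRing Λ]
variable {M : Type*} [AddCommGroup M] [Module Λ M]
variable {M₀ : Type*} [AddCommGroup M₀] [Module Λ M₀]

/-- `Col := Tw⁻¹ ∘ Col₀ ∘ tw`.  Here `σ = Tw_{χ_e} : Λ ≃+* Λ` is the twist automorphism (`g ↦ χ_e(g)·g`),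
`tw : M →ₛₗ[σ] M₀` the `σ`-semilinear identification `H¹_Iw(T(key)) ≅ H¹_Iw(T(key) ⊗ χ_e⁻¹)` (valid because
`χ_e` is a character OF THE TOWER), and `Col₀` the printed Coleman map of the unramified twist
`ℤ₂(β^{ur})` (Kato Ast. 295 §17.12 / de Shalit I.3 / Berger 2003, all at `p = 2`).  The transport is
`Λ`-LINEAR — no parity of `p` enters. -/
def twistTransport (σ : Λ ≃+* Λ) (tw : M →ₛₗ[(σ : Λ →+* Λ)] M₀) (Col₀ : M₀ →ₗ[Λ] Λ) : M →ₗ[Λ] Λ where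
  toFun m := σ.symm (Col₀ (tw m))
  map_add' x y := by simp only [map_add]
  map_smul' a m := by
    rw [LinearMap.map_smulₛₗ, LinearMap.map_smul, smul_eq_mul, map_mul, RingHom.id_apply, smul_eq_mul]
    congr 1
    exact σ.symm_apply_apply a

theorem twistTransport_apply (σ : Λ ≃+* Λ) (tw : M →ₛₗ[(σ : Λ →+* Λ)] M₀) (Col₀ : M₀ →ₗ[Λ] Λ)
    (m : M) : twistTransport σ tw Col₀ m = σ.symm (Col₀ (tw m)) := rfl

/-- Specialisation bookkeeping: the value of the transported functional at a character `φ : Λ →+* k`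
is the value of the printed one at the SHIFTED character `φ ∘ Tw_{χ_e}⁻¹` — so the interpolation
table of `Col` at `χ` is the table of `Col₀` at `χ·χ_e⁻¹` (conductor `2^{max(n,a)}`, `a = 2` for `e = −1`,
`a = 3` for `e = ±2`). -/
theorem eval_twistTransport {k : Type*} [CommRing k] (φ : Λ →+* k) (σ : Λ ≃+* Λ)
    (tw : M →ₛₗ[(σ : Λ →+* Λ)] M₀) (Col₀ : M₀ →ₗ[Λ] Λ) (m : M) :
    φ (twistTransport σ tw Col₀ m) = (φ.comp (σ.symm : Λ ≃+* Λ).toRingHom) (Col₀ (tw m)) := rfl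

/-- Images match: `Col(M) = Tw⁻¹(Col₀(tw(M)))`; in particular if `tw` is onto and `Col₀` is onto
(multiplicity-one statements for the UNRAMIFIED twist, in print) then `Col` is onto. -/
theorem twistTransport_surjective (σ : Λ ≃+* Λ) (tw : M →ₛₗ[(σ : Λ →+* Λ)] M₀) (Col₀ : M₀ →ₗ[Λ] Λ)
    (htw : Function.Surjective tw) (hCol₀ : Function.Surjective Col₀) :
    Function.Surjective (twistTransport σ tw Col₀) := by
  intro y
  obtain ⟨x, hx⟩ := hCol₀ (σ y)
  obtain ⟨m, hm⟩ := htw x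
  refine ⟨m, ?_⟩
  rw [twistTransport_apply, hm, hx]
  exact σ.symm_apply_apply y

end Twist

/-! ## §2  H2 — separation: a bounded series is determined by its value table -/

section Separation

variable {k : Type*} [Field k] {ι : Type*}

/-- The evaluation functionals `ev n` (values at the finite-order characters of the cyclotomic line)
SEPARATE the submodule `B` of bounded series: Weierstrass preparation — a non-zero element of
`ℤ₂⟦T⟧ ⊗ ℚ` has finitely many zeros in the open unit disc, while `ζ_{2^n} − 1`, `n ≥ n₀`, are infinitely
many such points. -/
def Separates (B : Submodule k (PowerSeries k)) (ev : ι → PowerSeries k →ₗ[k] k) : Prop :=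
  ∀ F ∈ B, (∀ n, ev n F = 0) → F = 0

theorem eq_of_separates {B : Submodule k (PowerSeries k)} {ev : ι → PowerSeries k →ₗ[k] k}
    (hsep : Separates B ev) {F G : PowerSeries k} (hF : F ∈ B) (hG : G ∈ B)
    (h : ∀ n, ev n F = ev n G) : F = G := by
  have h0 : F - G = 0 := hsep (F - G) (B.sub_mem hF hG) (fun n => by rw [map_sub, h n, sub_self])
  exact sub_eq_zero.mp h0

end Separation

/-! ## §3  H3 — `KLF_cyc(𝔮)` from two printed interpolation tables and one digit column -/

section Tables

variable {k : Type*} [Field k] {ι : Type*}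

/-- A (printed) interpolation table for the series `F` on the cyclotomic line: at the `n`-th finite-order
character, `ev n F = c n * L n` with `L n` the algebraic part of the critical value
`L(ψ_W·χ_n, 1)` and `c n` the normalisation column (Gauss sum · Euler factor · period⁻¹ · unit-root power). -/
structure ValueTable (ev : ι → PowerSeries k →ₗ[k] k) (F : PowerSeries k) where
  /-- normalisation column -/
  c : ι → k
  /-- critical-value column -/
  L : ι → k
  law : ∀ n, ev n F = c n * L n

variable {M : Type*} [AddCommGroup M] [Module k M]

/-- **R174″(b) re-typed.**  If the Kato-side table of `Col (u i)` (Coleman interpolation ∘ Kato Thm 12.5 (1),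
both in print at `p = 2`) and the Katz-side table of `𝓛 i` (de Shalit II.4.14 at `p = 2`) have the same
value column and the same normalisation column, then k3-g26's hypothesis `klf` holds VERBATIM. -/
theorem klf_of_tables {J : Type*} (Col : M →ₗ[k] PowerSeries k)
    (B : Submodule k (PowerSeries k)) (ev : ι → PowerSeries k →ₗ[k] k) (hsep : Separates B ev)
    (u : J → M) (𝓛 : J → PowerSeries k)
    (hColB : ∀ i, Col (u i) ∈ B) (h𝓛B : ∀ i, 𝓛 i ∈ B)
    (tK : ∀ i, ValueTable ev (Col (u i))) (tZ : ∀ i, ValueTable ev (𝓛 i))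
    (hL : ∀ i n, (tK i).L n = (tZ i).L n) (hc : ∀ i n, (tK i).c n = (tZ i).c n) :
    ∀ i, Col (u i) = 𝓛 i := fun i =>
  eq_of_separates hsep (hColB i) (h𝓛B i) fun n => by rw [(tK i).law n, (tZ i).law n, hL i n, hc i n]

/-- Same, with a PERIOD DIGIT `π i`: if the normalisation columns are proportional member by member,
`(tK i).c n = π i * (tZ i).c n`, the identification holds up to the scalar `π i`:
`Col (u i) = π i • 𝓛 i`.  (`π i` is the one value-grade constant this line leaves to be NAMED: Kato's
(15.11.1)-normalised period of `f_{Wᵢ}` against de Shalit's `⟨Ω, Ω_p⟩`.) -/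
theorem klf_scaled_of_tables {J : Type*} (Col : M →ₗ[k] PowerSeries k)
    (B : Submodule k (PowerSeries k)) (ev : ι → PowerSeries k →ₗ[k] k) (hsep : Separates B ev)
    (u : J → M) (𝓛 : J → PowerSeries k)
    (hColB : ∀ i, Col (u i) ∈ B) (h𝓛B : ∀ i, 𝓛 i ∈ B)
    (tK : ∀ i, ValueTable ev (Col (u i))) (tZ : ∀ i, ValueTable ev (𝓛 i))
    (π : J → k) (hL : ∀ i n, (tK i).L n = (tZ i).L n) (hc : ∀ i n, (tK i).c n = π i * (tZ i).c n) :
    ∀ i, Col (u i) = π i • 𝓛 i := fun i =>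
  eq_of_separates hsep (hColB i) (B.smul_mem (π i) (h𝓛B i)) fun n => by
    rw [(tK i).law n, map_smul, (tZ i).law n, hL i n, hc i n, smul_eq_mul, mul_assoc]

/-- The value column is COMMON by construction: both sides interpolate the same critical values
`L(ψ_{Wᵢ}χ, 1) = L(f_{Wᵢ}, χ, 1)` (Kato 15.10: `L(f,s) = L(ψ,s)`); recorded as the trivial re-basing lemma
used when the two printed tables quote the values with different Euler factors removed
(`(tK i).L n = e n * L₀ n`, `(tZ i).L n = e n * L₀ n` for the same finite Euler/imprimitivity column `e`). -/
theorem value_columns_agree {J : Type*} (LK LZ L₀ : J → ι → k) (e : ι → k)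
    (hK : ∀ i n, LK i n = e n * L₀ i n) (hZ : ∀ i n, LZ i n = e n * L₀ i n) :
    ∀ i n, LK i n = LZ i n := fun i n => by rw [hK, hZ]

end Tables

/-! ## §4  H4 — what the digit does downstream (derivative coefficient; norm currency) -/

section Digit

variable {k : Type*} [Field k]

/-- The `(3)₂` node consumes `coeff 1 (Col u)` (k3-g26 `derivativeLaw_of_valueLaw`); under the scaled
identification it is `π • coeff 1 𝓛`. -/
theorem coeff_smul_eq (π : k) (𝓛 : PowerSeries k) (n : ℕ) : coeff n (π • 𝓛) = π * coeff n 𝓛 := by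
  rw [map_smul, smul_eq_mul]

/-- Derivative-level law with the digit made explicit: from k3-g26's value law shape
`t = c₀ * coeff 1 (Col u) * ℓ` and `Col u = π • 𝓛` one gets `t = (c₀ * π) * coeff 1 𝓛 * ℓ` — the key
constant of `(3)₂` becomes `c₀ · π_W`; KEY-UNIFORMITY therefore needs `π_W` constant on a key up to units. -/
theorem derivative_law_scaled {M : Type*} [AddCommGroup M] [Module k M] (Col : M →ₗ[k] PowerSeries k)
    (u : M) (𝓛 : PowerSeries k) (π c₀ ℓ t : k) (hklf : Col u = π • 𝓛)
    (hder : t = c₀ * coeff 1 (Col u) * ℓ) : t = (c₀ * π) * coeff 1 𝓛 * ℓ := by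
  rw [hder, hklf, coeff_smul_eq]; ring

/-- NORM currency: a digit of valuation one is invisible. -/
theorem unit_digit_invisible {Γ₀ : Type*} [LinearOrderedCommGroupWithZero Γ₀] (v : Valuation k Γ₀)
    (π x : k) (hπ : v π = 1) : v (π * x) = v x := by
  rw [map_mul, hπ, one_mul]

/-- … and a digit that is constant on a key (same `π` for members `i, j`) cancels from RATIOS of the
key constants, which is all the key-uniform assembly of k3-g26 (`threeTwo_keyUniform_of_cut`) uses. -/
theorem key_digit_cancels (π a b : k) (hπ : π ≠ 0) : (π * a) / (π * b) = a / b := by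
  rw [mul_div_mul_left a b hπ]

end Digit

/-! ## §5  The `Δ`-descent digit at `p = 2` (only for `e ∈ {−1, −2}`)

For `e = 2` the character `χ_2` is a character of `Γ = Gal(ℚ₂^cyc/ℚ₂)` itself (`ℚ₂(√2)` is the first
layer), so NO descent from `G_∞ = Δ × Γ` is needed.  For `e ∈ {−1, −2}`, `χ_e|_Δ ≠ 1` and the passage
`H¹_Iw(ℚ₂(μ_{2^∞}), ·)_Δ → H¹_Iw(ℚ₂^cyc, ·)` costs at most ONE factor `2` (Kato Ast. 295 (12.1.2), p. 219:
`O[[G_∞]] → ∏_j O[[G_∞]]_j` injective with cokernel killed by `2`; k2-g12 `two_nsmul_mem_range_of_add_eq_zero`).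
The abstract statement: for an involution `c`, `2·n ∈ N^{c=1} + N^{c=−1}`. -/

section DeltaDescent

theorem delta_descent_killed_by_two {N : Type*} [AddCommGroup N] (c : N →+ N) (hc : ∀ x, c (c x) = x)
    (n : N) : ∃ a b : N, c a = a ∧ c b = -b ∧ a + b = 2 • n := by
  refine ⟨n + c n, n - c n, ?_, ?_, ?_⟩
  · rw [map_add, hc, add_comm]
  · rw [map_sub, hc, neg_sub]
  · rw [two_nsmul]; abel

end DeltaDescent


/-! ## §6  H2′ PROVED — the separation lemma behind `Separates`, at every prime INCLUDING `p = 2`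

`ω_n := (1 + X)^{p^n} − 1 ∈ ℤ_p⟦X⟧`; "`F` vanishes at `ζ_{p^m} − 1` for all `m ≤ n`" is `ω_n ∣ F`.  A series in
`ℤ_p⟦X⟧` divisible by every `ω_n` is `0`: reduce mod `p` (`ω̄_n = X^{p^n}`, so `F̄ = 0`), lift `F = p·F₁`,
cancel (`ℤ_p⟦X⟧` and `𝔽_p⟦X⟧` are domains) to get `ω_n ∣ F₁` again, and conclude `p^k ∣` every
coefficient for every `k`.  This is the algebraic form of "a bounded measure on the cyclotomic line is
determined by its values at the finite-order characters" used by `klf_of_tables` (instantiate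
`ev n :=` evaluation at `ζ_{p^n} − 1` after `⊗ ℚ_p(ζ_{p^n})`, `B := ℤ_p⟦X⟧ ⊗ ℚ`). -/

section OmegaSeparation

variable {p : ℕ} [hp : Fact p.Prime]

/-- `ω_n = (1 + X)^{p^n} − 1`. -/
noncomputable def omega (n : ℕ) : PowerSeries ℤ_[p] := (PowerSeries.X + 1) ^ (p ^ n) - 1

theorem map_omega (n : ℕ) :
    PowerSeries.map (PadicInt.toZMod (p := p)) (omega (p := p) n) = PowerSeries.X ^ (p ^ n) := by
  haveI : CharP (PowerSeries (ZMod p)) p :=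
    charP_of_injective_algebraMap (algebraMap (ZMod p) (PowerSeries (ZMod p))).injective p
  simp only [omega, map_sub, map_pow, map_add, PowerSeries.map_X, map_one]
  rw [add_pow_char_pow, one_pow, add_sub_cancel_right]

/-- Lifting: a series whose reduction mod `p` vanishes is `p` times a series. -/
theorem exists_eq_C_mul_of_map_toZMod_eq_zero (G : PowerSeries ℤ_[p])
    (h : PowerSeries.map (PadicInt.toZMod (p := p)) G = 0) :
    ∃ G₁ : PowerSeries ℤ_[p], G = PowerSeries.C (p : ℤ_[p]) * G₁ := by
  have hm : ∀ m, ∃ c : ℤ_[p], c * p = PowerSeries.coeff m G := by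
    intro m
    have h1 : PadicInt.toZMod (PowerSeries.coeff m G) = 0 := by
      rw [← PowerSeries.coeff_map, h, map_zero]
    have h2 : PowerSeries.coeff m G ∈ RingHom.ker (PadicInt.toZMod (p := p)) := by
      rwa [RingHom.mem_ker]
    rw [PadicInt.ker_toZMod, PadicInt.maximalIdeal_eq_span_p] at h2
    exact Ideal.mem_span_singleton'.mp h2
  refine ⟨PowerSeries.mk fun m => Classical.choose (hm m), PowerSeries.ext fun m => ?_⟩
  rw [PowerSeries.coeff_C_mul, PowerSeries.coeff_mk, mul_comm]
  exact (Classical.choose_spec (hm m)).symm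

theorem C_natCast_p_ne_zero : PowerSeries.C (p : ℤ_[p]) ≠ 0 := by
  intro h0
  have h1 : (p : ℤ_[p]) = 0 := by simpa using congrArg PowerSeries.constantCoeff h0
  exact hp.out.ne_zero (by exact_mod_cast h1)

/-- Cancellation step: `ω_n ∣ p·F₁ ⇒ ω_n ∣ F₁` (because `ω̄_n = X^{p^n}` is a non-zero-divisor mod `p`). -/
theorem omega_dvd_of_omega_dvd_C_mul (n : ℕ) (F₁ : PowerSeries ℤ_[p])
    (h : omega (p := p) n ∣ PowerSeries.C (p : ℤ_[p]) * F₁) : omega (p := p) n ∣ F₁ := by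
  obtain ⟨G, hG⟩ := h
  have hp0 : PadicInt.toZMod (p : ℤ_[p]) = 0 := by
    rw [map_natCast, ZMod.natCast_self]
  have hbar : PowerSeries.map (PadicInt.toZMod (p := p)) G = 0 := by
    have h' := congrArg (PowerSeries.map (PadicInt.toZMod (p := p))) hG
    rw [map_mul, map_mul, map_omega, PowerSeries.map_C, hp0, map_zero, zero_mul] at h'
    exact (mul_eq_zero.mp h'.symm).resolve_left (pow_ne_zero _ PowerSeries.X_ne_zero)
  obtain ⟨G₁, hG₁⟩ := exists_eq_C_mul_of_map_toZMod_eq_zero G hbar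
  refine ⟨G₁, mul_left_cancel₀ C_natCast_p_ne_zero ?_⟩
  rw [hG, hG₁]; ring

theorem forall_pow_dvd_coeff_of_forall_omega_dvd (k : ℕ) :
    ∀ F : PowerSeries ℤ_[p], (∀ n, omega (p := p) n ∣ F) → ∀ m, (p : ℤ_[p]) ^ k ∣ PowerSeries.coeff m F := by
  induction k with
  | zero => intro F _ m; simp
  | succ k ih =>
    intro F hF m
    have hbar : PowerSeries.map (PadicInt.toZMod (p := p)) F = 0 := by
      ext j
      simp only [map_zero]
      have hj : j < p ^ j := Nat.lt_pow_self hp.out.one_lt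
      have hdvd : PowerSeries.X ^ (p ^ j) ∣ PowerSeries.map (PadicInt.toZMod (p := p)) F := by
        rw [← map_omega j]; exact map_dvd _ (hF j)
      exact PowerSeries.X_pow_dvd_iff.mp hdvd j hj
    obtain ⟨F₁, hF₁⟩ := exists_eq_C_mul_of_map_toZMod_eq_zero F hbar
    have hF₁' : ∀ n, omega (p := p) n ∣ F₁ := fun n =>
      omega_dvd_of_omega_dvd_C_mul n F₁ (hF₁ ▸ hF n)
    have hk := ih F₁ hF₁' m
    rw [hF₁, PowerSeries.coeff_C_mul, pow_succ']
    exact mul_dvd_mul_left _ hk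

/-- **H2′ (separation).**  A power series over `ℤ_p` divisible by `(1+X)^{p^n} − 1` for every `n` is zero —
any prime `p`, in particular `p = 2`. -/
theorem eq_zero_of_forall_omega_dvd (F : PowerSeries ℤ_[p]) (hF : ∀ n, omega (p := p) n ∣ F) : F = 0 := by
  ext m
  simp only [map_zero]
  have hk : ∀ k, (p : ℤ_[p]) ^ k ∣ PowerSeries.coeff m F :=
    fun k => forall_pow_dvd_coeff_of_forall_omega_dvd k F hF m
  have hnorm : ∀ k, ‖PowerSeries.coeff m F‖ ≤ ((p : ℝ)⁻¹) ^ k := by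
    intro k
    obtain ⟨b, hb⟩ := hk k
    rw [hb]
    calc ‖(p : ℤ_[p]) ^ k * b‖ ≤ ‖(p : ℤ_[p]) ^ k‖ * ‖b‖ := norm_mul_le _ _
      _ ≤ ‖(p : ℤ_[p])‖ ^ k * 1 :=
          mul_le_mul (norm_pow_le _ _) (PadicInt.norm_le_one b) (norm_nonneg _) (by positivity)
      _ = ((p : ℝ)⁻¹) ^ k := by rw [mul_one, PadicInt.norm_p]
  have ht : Filter.Tendsto (fun k : ℕ => ((p : ℝ)⁻¹) ^ k) Filter.atTop (nhds 0) :=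
    tendsto_pow_atTop_nhds_zero_of_lt_one (by positivity)
      (inv_lt_one_of_one_lt₀ (by exact_mod_cast hp.out.one_lt))
  have h0 : ‖PowerSeries.coeff m F‖ ≤ 0 := ge_of_tendsto' ht hnorm
  exact norm_le_zero_iff.mp h0

/-- Two series with `ω_n ∣ F − G` for all `n` (same values at every `ζ_{p^n} − 1`) are equal. -/
theorem eq_of_forall_omega_dvd_sub (F G : PowerSeries ℤ_[p]) (h : ∀ n, omega (p := p) n ∣ F - G) : F = G :=
  sub_eq_zero.mp (eq_zero_of_forall_omega_dvd (F - G) h)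

end OmegaSeparation

end Summit.BirchSwinnertonDyer.BirchSwinnertonDyer.Cruxes.SplitBadTwoLowerHalfOfFacts.KatoColemanK2G28
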